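import Summits.HodgeConjecture.HodgeConjecture.Theorems.F0P2oYCoinvariantsCM               -- ★ A-p12 (g17): the CM closer (its §1 scalar lemmas, the docking pattern)
import Summits.HodgeConjecture.HodgeConjecture.Theorems.F0P2oPairFrameOfFormCongruence     -- ★ p832092: the pair frame package
import Summits.HodgeConjecture.HodgeConjecture.Theorems.F0P2oCmLineDockingMatrix           -- ★ p832169 (F0P3a-p03 (g8)): the two docking identities
import Literature.NumberTheory.GelbartRogawski1991.FiniteAdelicSplittingAssembly          -- ★ `iota`, `localSchrodinger`
import Literature.NumberTheory.GelbartRogawski1991.UnitaryDualPairThetaKernelCM          -- ★ `imagUnit`, `realDiagonal`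
import Literature.NumberTheory.GelbartRogawski1991.UnitaryDualPairSplittingDatum         -- ★ `gram`, `isUnit_det_gram`
import Literature.NumberTheory.Automorphic.Liu2021.Def411WeilCarriers                    -- ★ `TW`, `JW`
import Literature.NumberTheory.Automorphic.UnitaryGroupDualPairLocalLine                 -- ★ `localLineInl`
import Literature.NumberTheory.Automorphic.LocalUnitaryGroupCongr                        -- ★ `cmDatumLocalCongr`
import Literature.NumberTheory.Automorphic.UnitaryGroupBorelInduction                     -- ★ `cmBorelTriple`, `cmLocalForm_eq_over`, `torusEntry`
import Literature.NumberTheory.Automorphic.UnitaryGroupRankOneBigCell                     -- ★ p831034: `U(σ, Φ₃)(K)` by entries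
import Literature.NumberTheory.Automorphic.UnitaryGroupNonsplitPlace                      -- ★ `LocalRing.isField_of_smul_eq`
import HarnessLib

/-!
# Crux `H413`, programme P2, N3 road (D3d) — THE FRAME INPUTS OF THE SWAP/SIEGEL BRICK AT THE CM PAIR: the isotropic frame vector `y = T e₀ ⊗ w₀`,
# its partner `ys = u⁻¹ T e₂ ⊗ w₀`, and how `N(ℓ)` and the split torus `d(α, 1, ᾱ⁻¹)` of `U(Φ₃)(L⁺_v)` move them (`g y = α y`, `g b ∈ b + S y` on `y^⊥`)

Cell hodgecm-mathlib (D-0151), FLOOR 0, crux item H413 = stmt-HodgeConjecture-24833, programme P2; N3 road note v2 §2, brick (D3d) THE ASSEMBLER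
(lead B-p18 (g28); seat A-p16 (g24)).  This file discharges the hypotheses `(F)` `(hgy)` `(hgb)` of F0P3a-p03 (g8)'s (C3′) «swap + Siegel memberships»
(`Theorems/F0P2oDoubledSwapSiegel.lean`, heads 2026-08-31T21:17:21Z) for the two families of elements the (D3d) assembler feeds it: the unipotent radical
`N = (cmBorelTriple L 3 v).N` (with `α = 1`) and the torus elements `t` with middle entry `1` (with `α = torusEntry … 0 t`).  THEOREMS ONLY (no `def`, no
instance, no notation, no named fact, no `sorry`); never imports a `Cruxes/…/Lines` module; kernel lane `--supports stmt-HodgeConjecture-24833 --as helper`.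
HC_CM is proved only modulo the printed citations until rung 0 closes; nothing printed is asserted here.

THE STATEMENT `exists_frame_swapSiegel_inputs_of_nonsplit`: in the setting of ★ A-p12 `F0P2oYCoinvariantsCM.exists_coinvariants_equiv_schwartz_of_nonsplit`
(CM field `L`, `v ∤ ∞` non-split, `dV` real non-zero, `ε` a unit, `e₁ : Fin 3 × Fin 1 ≃ Fin n′`, a form congruence `(T, a, h)`), with
`G := (localGram L⁺ n′ (gram e₁ (realDiagonal dV) (TW ε)) v).map (toLocalRing L v)` (= ★ `gramS`), `h := hermForm (conjLocal L c̄ v) G`, and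
`gMat g :=` the matrix over `S = L ⊗ L⁺_v` of `localLineInl (localPiEquiv⁻¹ (cmDatumLocalCongr T g))` (★ p832169: `reindex e₁ e₁ ((T g T⁻¹) ⊗ₖ 1)`):
there are `y ys : Fin n′ → S` with `h(y,y) = 0`, `h(ys,y) = 1`, `h(y,ys) = 1` such that (N) every `nn ∈ (cmBorelTriple L 3 v).N` has `gMat nn y = (1:S) • y` and
`∀ b, h(y,b) = 0 → ∃ s, gMat nn b = b + s • y`; (T) every torus element `t` with `torusEntry … 1 t = 1` has `gMat t y = (torusEntry … 0 t : S) • y` and the same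
`y^⊥`-property.  Proof: A-p12's docking + frame package verbatim (★ p832092 `pairFrame_*`, ★ p832169), ★ `exists_coe_eq_upper_of_mem_unipotentU` ∕
`pairFrame_action_upper` for (N), ★ `exists_coe_eq_diagonal_of_mem_torusU` ∕ `conj_diagonal_mulVec_col` for (T), and the expansion ★ `pairFrame_hexp` on `y^⊥`.
[Rogawski1990, §1.10 p. 9; MoeglinVignerasWaldspurger1987, Chap. 3 §IV.2; Kudla1994, §2.]

## References
* [Rogawski1990] J. D. Rogawski, Ann. of Math. Stud. 123 (1990): §1.9 p. 8, §1.10 p. 9.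
* [MoeglinVignerasWaldspurger1987] C. Mœglin, M.-F. Vignéras, J.-L. Waldspurger, LNM 1291 (1987): Chap. 3 §IV.2.
* [Kudla1994] S. Kudla, Israel J. Math. 87 (1994), §2.
-/

set_option autoImplicit false
set_option linter.dupNamespace false -- the mandated namespace repeats the single-problem summit's segment

noncomputable section

open scoped MatrixGroups Kronecker
open _root_.Matrix NumberField IsDedekindDomain
open Literature.NumberTheory.Automorphic Literature.NumberTheory.Automorphic.UnitaryGroup
open Literature.NumberTheory.Automorphic.UnitaryGroup.QuadraticCoordinates Literature.NumberTheory.Automorphic.UnitaryGroup.IsQuadraticCoordinates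
open Literature.NumberTheory.Automorphic.Liu2021 Literature.NumberTheory.Automorphic.Liu2021.Def411WeilCarriers
open Literature.NumberTheory.GelbartRogawski1991 Literature.NumberTheory.GelbartRogawski1991.UnitaryDualPair
open Literature.NumberTheory.GelbartRogawski1991.UnitaryDualPair.LocalSplitting
open Literature.RepresentationTheory Literature.RepresentationTheory.HeisenbergGroup
open Summit.HodgeConjecture.HodgeConjecture.Cruxes.H413.F0P2oPairFrameOfFormCongruence
open Summit.HodgeConjecture.HodgeConjecture.Cruxes.H413.F0P2oFrameOfFormCongruence
open Summit.HodgeConjecture.HodgeConjecture.Cruxes.H413.F0P2oCmLineDockingMatrix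
open Summit.HodgeConjecture.HodgeConjecture.Cruxes.H413.F0P2oYCoinvariantsCM

namespace Summit.HodgeConjecture.HodgeConjecture.Cruxes.H413.F0P2oThetaJacquetTorusFrame

/-! ## §1 A two-term vector under a matrix scaling the first term and shearing the second -/

section Linear

variable {S : Type*} [CommRing S] {m : Type*} [Fintype m]

/-- if `b = r • y + s • b₀`, `G y = α • y` and `G b₀ = b₀ + μ • y`, then `G b = b + (r * (α - 1) + s * μ) • y`. [folklore] -/
theorem mulVec_eq_add_smul_of_two_term (G : Matrix m m S) {y b₀ b : m → S} {r s α μ : S} (hb : b = r • y + s • b₀)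
    (hy : G *ᵥ y = α • y) (hb₀ : G *ᵥ b₀ = b₀ + μ • y) : G *ᵥ b = b + (r * (α - 1) + s * μ) • y := by
  rw [hb, Matrix.mulVec_add, Matrix.mulVec_smul, Matrix.mulVec_smul, hy, hb₀]
  module

end Linear

/-! ## §2 The frame inputs at the CM pair -/

variable (L : Type) [Field L] [NumberField L] [IsCMField L]

set_option synthInstance.maxHeartbeats 400000 in
set_option maxHeartbeats 8000000 in
/-- **THE FRAME INPUTS `(F)`, `(hgy)`, `(hgb)` OF THE SWAP/SIEGEL BRICK, FOR `N(ℓ)` AND FOR `d(α, 1, ᾱ⁻¹)`** (see the module docstring).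
[cite: Rogawski1990, §1.10 p. 9] [cite: MoeglinVignerasWaldspurger1987, Chap. 3 §IV.2] [cite: Kudla1994, §2] -/
theorem exists_frame_swapSiegel_inputs_of_nonsplit {n' : ℕ} (e₁ : Fin 3 × Fin 1 ≃ Fin n') (dV : Fin 3 → L)
    (hdV : ∀ i, IsCMField.complexConj L (dV i) = dV i) (hdV0 : ∀ i, dV i ≠ 0) (ε : (↥(maximalRealSubfield L))ˣ)
    (v : HeightOneSpectrum (𝓞 ↥(maximalRealSubfield L))) (hv : ∀ w : PlacesOver L v, IsCMField.complexConj L • w.1 = w.1)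
    (T : GL (Fin 3) (UnitaryGroup.LocalRing L v)) {a : UnitaryGroup.LocalRing L v} (ha : IsUnit a)
    (h : formCongr (conjLocal L (IsCMField.complexConj L) v) T ((Matrix.diagonal dV).map (algebraMap L (UnitaryGroup.LocalRing L v))) =
      a • (Matrix.of fun i j : Fin 3 => if i.val + j.val + 1 = 3 then (1 : L) else 0).map (algebraMap L (UnitaryGroup.LocalRing L v))) :
    ∃ y ys : Fin n' → UnitaryGroup.LocalRing L v,
      hermForm (conjLocal L (IsCMField.complexConj L) v)
          ((localGram (↥(maximalRealSubfield L)) n' (gram (↥(maximalRealSubfield L)) e₁ (realDiagonal L dV hdV) (TW (↥(maximalRealSubfield L)) ε)) v).map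
            (toLocalRing L v)) y y = 0 ∧
      hermForm (conjLocal L (IsCMField.complexConj L) v)
          ((localGram (↥(maximalRealSubfield L)) n' (gram (↥(maximalRealSubfield L)) e₁ (realDiagonal L dV hdV) (TW (↥(maximalRealSubfield L)) ε)) v).map
            (toLocalRing L v)) ys y = 1 ∧
      hermForm (conjLocal L (IsCMField.complexConj L) v)
          ((localGram (↥(maximalRealSubfield L)) n' (gram (↥(maximalRealSubfield L)) e₁ (realDiagonal L dV hdV) (TW (↥(maximalRealSubfield L)) ε)) v).map
            (toLocalRing L v)) y ys = 1 ∧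
      (∀ nn ∈ (cmBorelTriple L 3 v).N,
        (((localPiEquiv L (IsCMField.complexConj L) n' (Matrix.reindex e₁ e₁ (Matrix.diagonal dV ⊗ₖ JW (↥(maximalRealSubfield L)) L ε)) v
            (localLineInl L (IsCMField.complexConj L) 3 e₁ (Matrix.diagonal dV) (JW (↥(maximalRealSubfield L)) L ε) v
              ((localPiEquiv L (IsCMField.complexConj L) 3 (Matrix.diagonal dV) v).symm
                (cmDatumLocalCongr L v T ha h (nn : ↥(unitaryGroupOfForm (conjLocal L (IsCMField.complexConj L) v) (cmLocalForm L 3 v)))))) :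
              ↥(UnitaryGroup.«local» L (IsCMField.complexConj L) n' (Matrix.reindex e₁ e₁ (Matrix.diagonal dV ⊗ₖ JW (↥(maximalRealSubfield L)) L ε)) v)) :
              GL (Fin n') (UnitaryGroup.LocalRing L v)) : Matrix (Fin n') (Fin n') (UnitaryGroup.LocalRing L v)) *ᵥ y = (1 : UnitaryGroup.LocalRing L v) • y ∧
        ∀ b : Fin n' → UnitaryGroup.LocalRing L v,
          hermForm (conjLocal L (IsCMField.complexConj L) v)
              ((localGram (↥(maximalRealSubfield L)) n' (gram (↥(maximalRealSubfield L)) e₁ (realDiagonal L dV hdV) (TW (↥(maximalRealSubfield L)) ε)) v).map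
                (toLocalRing L v)) y b = 0 →
            ∃ s : UnitaryGroup.LocalRing L v,
              (((localPiEquiv L (IsCMField.complexConj L) n' (Matrix.reindex e₁ e₁ (Matrix.diagonal dV ⊗ₖ JW (↥(maximalRealSubfield L)) L ε)) v
                  (localLineInl L (IsCMField.complexConj L) 3 e₁ (Matrix.diagonal dV) (JW (↥(maximalRealSubfield L)) L ε) v
                    ((localPiEquiv L (IsCMField.complexConj L) 3 (Matrix.diagonal dV) v).symm
                      (cmDatumLocalCongr L v T ha h (nn : ↥(unitaryGroupOfForm (conjLocal L (IsCMField.complexConj L) v) (cmLocalForm L 3 v)))))) :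
                    ↥(UnitaryGroup.«local» L (IsCMField.complexConj L) n' (Matrix.reindex e₁ e₁ (Matrix.diagonal dV ⊗ₖ JW (↥(maximalRealSubfield L)) L ε)) v)) :
                    GL (Fin n') (UnitaryGroup.LocalRing L v)) : Matrix (Fin n') (Fin n') (UnitaryGroup.LocalRing L v)) *ᵥ b = b + s • y) ∧
      (∀ (t : ↥((cmBorelTriple L 3 v).M)), torusEntry (conjLocal L (IsCMField.complexConj L) v) (cmLocalForm L 3 v) 1 t = 1 →
        (((localPiEquiv L (IsCMField.complexConj L) n' (Matrix.reindex e₁ e₁ (Matrix.diagonal dV ⊗ₖ JW (↥(maximalRealSubfield L)) L ε)) v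
            (localLineInl L (IsCMField.complexConj L) 3 e₁ (Matrix.diagonal dV) (JW (↥(maximalRealSubfield L)) L ε) v
              ((localPiEquiv L (IsCMField.complexConj L) 3 (Matrix.diagonal dV) v).symm
                (cmDatumLocalCongr L v T ha h (t : ↥(unitaryGroupOfForm (conjLocal L (IsCMField.complexConj L) v) (cmLocalForm L 3 v)))))) :
              ↥(UnitaryGroup.«local» L (IsCMField.complexConj L) n' (Matrix.reindex e₁ e₁ (Matrix.diagonal dV ⊗ₖ JW (↥(maximalRealSubfield L)) L ε)) v)) :
              GL (Fin n') (UnitaryGroup.LocalRing L v)) : Matrix (Fin n') (Fin n') (UnitaryGroup.LocalRing L v)) *ᵥ y =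
            ((torusEntry (conjLocal L (IsCMField.complexConj L) v) (cmLocalForm L 3 v) 0 t : (UnitaryGroup.LocalRing L v)ˣ) : UnitaryGroup.LocalRing L v) • y ∧
        ∀ b : Fin n' → UnitaryGroup.LocalRing L v,
          hermForm (conjLocal L (IsCMField.complexConj L) v)
              ((localGram (↥(maximalRealSubfield L)) n' (gram (↥(maximalRealSubfield L)) e₁ (realDiagonal L dV hdV) (TW (↥(maximalRealSubfield L)) ε)) v).map
                (toLocalRing L v)) y b = 0 →
            ∃ s : UnitaryGroup.LocalRing L v,
              (((localPiEquiv L (IsCMField.complexConj L) n' (Matrix.reindex e₁ e₁ (Matrix.diagonal dV ⊗ₖ JW (↥(maximalRealSubfield L)) L ε)) v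
                  (localLineInl L (IsCMField.complexConj L) 3 e₁ (Matrix.diagonal dV) (JW (↥(maximalRealSubfield L)) L ε) v
                    ((localPiEquiv L (IsCMField.complexConj L) 3 (Matrix.diagonal dV) v).symm
                      (cmDatumLocalCongr L v T ha h (t : ↥(unitaryGroupOfForm (conjLocal L (IsCMField.complexConj L) v) (cmLocalForm L 3 v)))))) :
                    ↥(UnitaryGroup.«local» L (IsCMField.complexConj L) n' (Matrix.reindex e₁ e₁ (Matrix.diagonal dV ⊗ₖ JW (↥(maximalRealSubfield L)) L ε)) v)) :
                    GL (Fin n') (UnitaryGroup.LocalRing L v)) : Matrix (Fin n') (Fin n') (UnitaryGroup.LocalRing L v)) *ᵥ b = b + s • y) := by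
  classical
  -- the two docking identities ★ p832169 (F0P3a-p03 (g8))
  have hdock : ∀ g : (cmDatum L 3 (Matrix.diagonal dV)).Local v,
      (((localPiEquiv L (IsCMField.complexConj L) n' (Matrix.reindex e₁ e₁ (Matrix.diagonal dV ⊗ₖ JW (↥(maximalRealSubfield L)) L ε)) v
          (localLineInl L (IsCMField.complexConj L) 3 e₁ (Matrix.diagonal dV) (JW (↥(maximalRealSubfield L)) L ε) v
            ((localPiEquiv L (IsCMField.complexConj L) 3 (Matrix.diagonal dV) v).symm g)) :
            ↥(UnitaryGroup.«local» L (IsCMField.complexConj L) n' (Matrix.reindex e₁ e₁ (Matrix.diagonal dV ⊗ₖ JW (↥(maximalRealSubfield L)) L ε)) v)) :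
            GL (Fin n') (UnitaryGroup.LocalRing L v)) : Matrix (Fin n') (Fin n') (UnitaryGroup.LocalRing L v)) =
        Matrix.reindex e₁ e₁ (((g.val : GL (Fin 3) (UnitaryGroup.LocalRing L v)) : Matrix (Fin 3) (Fin 3) (UnitaryGroup.LocalRing L v)) ⊗ₖ
          (1 : Matrix (Fin 1) (Fin 1) (UnitaryGroup.LocalRing L v))) := fun g =>
    coe_coe_localPiEquiv_localLineInl_localPiEquiv_symm L (IsCMField.complexConj L) 3 e₁ (Matrix.diagonal dV) (JW (↥(maximalRealSubfield L)) L ε) v g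
  -- the quadratic coordinates of `S = L ⊗ L⁺_v` and the involution
  have hq := isQuadraticCoordinates_local L v (IsCMField.complexConj L) (complexConj_imagUnit L) (imagUnit_ne_zero L) (imagUnit_mul_self L)
  have hσφ : ∀ x : v.adicCompletion ↥(maximalRealSubfield L),
      conjLocal L (IsCMField.complexConj L) v (toLocalRing L v x) = toLocalRing L v x := fun x => conjLocal_toLocalRing (IsCMField.complexConj L) v x
  have hσδ : conjLocal L (IsCMField.complexConj L) v (algebraMap L (UnitaryGroup.LocalRing L v) (imagUnit L)) =
      -algebraMap L (UnitaryGroup.LocalRing L v) (imagUnit L) := by rw [conjLocal_algebraMap, complexConj_imagUnit, map_neg]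
  have hσσ : ∀ z, conjLocal L (IsCMField.complexConj L) v (conjLocal L (IsCMField.complexConj L) v z) = z := conjLocal_conjLocal_cm L v
  -- `S` is a field (non-split), `2` is a unit, `d` is not a square
  obtain ⟨w⟩ := PlacesOver.nonempty L v
  have hS : IsField (UnitaryGroup.LocalRing L v) := LocalRing.isField_of_smul_eq (IsCMField.complexConj L) (IsCMField.complexConj_ne_one L) w (hv w)
  have h2F : (2 : v.adicCompletion ↥(maximalRealSubfield L)) ≠ 0 := two_ne_zero
  have h2 : (2 : UnitaryGroup.LocalRing L v) ≠ 0 := by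
    intro h0
    apply h2F
    have : toLocalRing L v 2 = toLocalRing L v 0 := by rw [map_ofNat, map_zero, h0]
    exact (toLocalRing L v).injective this
  have hδ0 : algebraMap L (UnitaryGroup.LocalRing L v) (imagUnit L) ≠ 0 :=
    (map_ne_zero_iff _ (algebraMap L (UnitaryGroup.LocalRing L v)).injective).2 (imagUnit_ne_zero L)
  have hd := mul_self_ne_of_isField hq hS hσφ hσδ hδ0 h2
  -- the real Gram `𝕋_v` of the pair: symmetric, invertible
  have hT : (localGram (↥(maximalRealSubfield L)) n' (gram (↥(maximalRealSubfield L)) e₁ (realDiagonal L dV hdV) (TW (↥(maximalRealSubfield L)) ε)) v).IsSymm :=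
    (isSymm_gram (↥(maximalRealSubfield L)) e₁ (realDiagonal_isSymm L dV hdV) (isSymm_TW (↥(maximalRealSubfield L)) ε)).map _
  have hTd : IsUnit (localGram (↥(maximalRealSubfield L)) n'
      (gram (↥(maximalRealSubfield L)) e₁ (realDiagonal L dV hdV) (TW (↥(maximalRealSubfield L)) ε)) v).det :=
    isUnit_det_map _ (isUnit_det_gram (↥(maximalRealSubfield L)) e₁ (isUnit_det_realDiagonal L dV hdV hdV0) (isUnit_det_TW (↥(maximalRealSubfield L)) ε))
  -- the hermitian form of the pair on `S^{n'}` is `reindex e₁ (H_V ⊗ H_W)`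
  obtain ⟨HV, hHV⟩ : ∃ HV : Matrix (Fin 3) (Fin 3) (UnitaryGroup.LocalRing L v),
      HV = (Matrix.diagonal dV).map (algebraMap L (UnitaryGroup.LocalRing L v)) := ⟨_, rfl⟩
  obtain ⟨HW, hHW⟩ : ∃ HW : Matrix (Fin 1) (Fin 1) (UnitaryGroup.LocalRing L v),
      HW = (JW (↥(maximalRealSubfield L)) L ε).map (algebraMap L (UnitaryGroup.LocalRing L v)) := ⟨_, rfl⟩
  have hH : (localGram (↥(maximalRealSubfield L)) n' (gram (↥(maximalRealSubfield L)) e₁ (realDiagonal L dV hdV) (TW (↥(maximalRealSubfield L)) ε)) v).map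
      (toLocalRing L v) = Matrix.reindex e₁ e₁ (HV ⊗ₖ HW) := by
    rw [localGram, ← localForm_eq_map L n' v _ (reindex_kronecker_eq_gram_map (↥(maximalRealSubfield L)) L e₁ (realDiagonal_map L dV hdV).symm
      (JW_eq (↥(maximalRealSubfield L)) L ε)), adelicForm, Matrix.map_map, hHV, hHW, kronecker_map_map]
    have hcomp : ((adeleToLocal L v : AdeleRing (𝓞 L) L →+* UnitaryGroup.LocalRing L v) : AdeleRing (𝓞 L) L → UnitaryGroup.LocalRing L v) ∘
        (algebraMap L (AdeleRing (𝓞 L) L)) = algebraMap L (UnitaryGroup.LocalRing L v) := funext fun e => adeleToLocal_algebraMap L v e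
    rw [hcomp]
    ext i j
    simp only [Matrix.reindex_apply, Matrix.submatrix_apply, Matrix.map_apply]
  -- the unit `u = a · ε′` of the frame and its reality
  have hW00 : HW 0 0 = algebraMap L (UnitaryGroup.LocalRing L v) (algebraMap (↥(maximalRealSubfield L)) L (ε : ↥(maximalRealSubfield L))) := by
    rw [hHW, Matrix.map_apply, JW_eq, Matrix.map_apply, TW]; rfl
  have hW : IsUnit (HW 0 0) := by rw [hW00]; exact (ε.isUnit.map _).map _
  have hA : ∀ i j : Fin 3, ((Matrix.of fun i j : Fin 3 => if i.val + j.val + 1 = 3 then (1 : L) else 0).map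
      (algebraMap L (UnitaryGroup.LocalRing L v))) i j = if i.val + j.val + 1 = 3 then 1 else 0 := fun i j => by
    rw [Matrix.map_apply, Matrix.of_apply]; split_ifs <;> simp
  have h' : formCongr (conjLocal L (IsCMField.complexConj L) v) T HV = ((ha.unit : (UnitaryGroup.LocalRing L v)ˣ) : UnitaryGroup.LocalRing L v) •
      (Matrix.of fun i j : Fin 3 => if i.val + j.val + 1 = 3 then (1 : L) else 0).map (algebraMap L (UnitaryGroup.LocalRing L v)) := by
    rw [hHV, IsUnit.unit_spec]; exact h
  have hcc : ∀ i j : Fin 3, hermForm (conjLocal L (IsCMField.complexConj L) v) HV ((T : Matrix (Fin 3) (Fin 3) _).col i)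
      ((T : Matrix (Fin 3) (Fin 3) _).col j) * HW 0 0 =
        if i.val + j.val + 1 = 3 then ((ha.unit * hW.unit : (UnitaryGroup.LocalRing L v)ˣ) : UnitaryGroup.LocalRing L v) else 0 :=
    fun i j => by rw [hermForm_col_col_eq _ HV T ha.unit hA h', ite_mul, zero_mul, Units.val_mul, hW.unit_spec]
  have hHVh : (HV.map (conjLocal L (IsCMField.complexConj L) v))ᵀ = HV := by
    rw [hHV, Matrix.diagonal_map (map_zero _), Matrix.diagonal_map (map_zero _), Matrix.diagonal_transpose]
    congr 1
    funext i
    rw [conjLocal_algebraMap, hdV]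
  have hσW : conjLocal L (IsCMField.complexConj L) v (HW 0 0) = HW 0 0 := by rw [hW00, conjLocal_algebraMap, AlgEquiv.commutes]
  have hσu : conjLocal L (IsCMField.complexConj L) v ((ha.unit * hW.unit : (UnitaryGroup.LocalRing L v)ˣ) : UnitaryGroup.LocalRing L v) =
      ((ha.unit * hW.unit : (UnitaryGroup.LocalRing L v)ˣ) : UnitaryGroup.LocalRing L v) := by
    rw [Units.val_mul, map_mul, map_unit_eq _ HV T ha.unit hA h' hσσ hHVh, hW.unit_spec, hσW]
  obtain ⟨u, hudef⟩ : ∃ u : (UnitaryGroup.LocalRing L v)ˣ, u = ha.unit * hW.unit := ⟨_, rfl⟩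
  rw [← hudef] at hcc hσu
  obtain ⟨a₀, ha₀def⟩ : ∃ a₀ : v.adicCompletion ↥(maximalRealSubfield L),
      a₀ = re (quadraticLocalEquiv L v (IsCMField.complexConj L) (complexConj_imagUnit L) (imagUnit_ne_zero L)).toLinearEquiv.toAddEquiv
        (u : UnitaryGroup.LocalRing L v) := ⟨_, rfl⟩
  have hu : (u : UnitaryGroup.LocalRing L v) = toLocalRing L v a₀ := by rw [ha₀def]; exact eq_map_re_of_conj_eq hq hσφ hσδ h2F hσu
  have ha₀ : a₀ ≠ 0 := fun h0 => u.ne_zero (by rw [hu, h0, map_zero])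
  have hφa : toLocalRing L v a₀⁻¹ = ((u⁻¹ : (UnitaryGroup.LocalRing L v)ˣ) : UnitaryGroup.LocalRing L v) :=
    (Units.inv_eq_of_mul_eq_one_right (show (u : UnitaryGroup.LocalRing L v) * toLocalRing L v a₀⁻¹ = 1 by
      rw [hu, ← map_mul, mul_inv_cancel₀ ha₀, map_one])).symm
  -- the lift `x ⊗ w₀` and the frame package ★ p832092
  obtain ⟨Lf, hLf⟩ : ∃ Lf : (Fin 3 → UnitaryGroup.LocalRing L v) →ₗ[UnitaryGroup.LocalRing L v] (Fin n' → UnitaryGroup.LocalRing L v),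
      ∀ x k, Lf x k = x (e₁.symm k).1 :=
    ⟨LinearMap.funLeft (UnitaryGroup.LocalRing L v) (UnitaryGroup.LocalRing L v) (fun k => (e₁.symm k).1), fun _ _ => rfl⟩
  -- the group side: the chain `Gqs → localPi`, the splitting `s`, the matrix action `M`
  obtain ⟨ch, hch⟩ : ∃ ch : (cmDatum L 3 (Matrix.of fun i j : Fin 3 => if i.val + j.val + 1 = 3 then (1 : L) else 0)).Local v →*
      localPi L (IsCMField.complexConj L) n' (Matrix.reindex e₁ e₁ (Matrix.diagonal dV ⊗ₖ JW (↥(maximalRealSubfield L)) L ε)) v,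
      ch = (localLineInl L (IsCMField.complexConj L) 3 e₁ (Matrix.diagonal dV) (JW (↥(maximalRealSubfield L)) L ε) v).comp
          ((localPiEquiv L (IsCMField.complexConj L) 3 (Matrix.diagonal dV) v).symm.toMonoidHom.comp
            (cmDatumLocalCongr L v T ha h).toMonoidHom) := ⟨_, rfl⟩
  have hchap : ∀ g, ch g = localLineInl L (IsCMField.complexConj L) 3 e₁ (Matrix.diagonal dV) (JW (↥(maximalRealSubfield L)) L ε) v
      ((localPiEquiv L (IsCMField.complexConj L) 3 (Matrix.diagonal dV) v).symm (cmDatumLocalCongr L v T ha h g)) := fun g => by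
    rw [hch]; rfl
  obtain ⟨M, hMval⟩ : ∃ M : (cmDatum L 3 (Matrix.of fun i j : Fin 3 => if i.val + j.val + 1 = 3 then (1 : L) else 0)).Local v →*
      GL (Fin n') (UnitaryGroup.LocalRing L v), ∀ g, M g =
        ((localPiEquiv L (IsCMField.complexConj L) n' (Matrix.reindex e₁ e₁ (Matrix.diagonal dV ⊗ₖ JW (↥(maximalRealSubfield L)) L ε)) v (ch g) :
          ↥(UnitaryGroup.«local» L (IsCMField.complexConj L) n' (Matrix.reindex e₁ e₁ (Matrix.diagonal dV ⊗ₖ JW (↥(maximalRealSubfield L)) L ε)) v)) :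
          GL (Fin n') (UnitaryGroup.LocalRing L v)) :=
    ⟨(UnitaryGroup.«local» L (IsCMField.complexConj L) n' (Matrix.reindex e₁ e₁ (Matrix.diagonal dV ⊗ₖ JW (↥(maximalRealSubfield L)) L ε)) v).subtype.comp
      ((localPiEquiv L (IsCMField.complexConj L) n' (Matrix.reindex e₁ e₁ (Matrix.diagonal dV ⊗ₖ JW (↥(maximalRealSubfield L)) L ε)) v).toMonoidHom.comp ch),
      fun _ => rfl⟩
  -- the matrix of `M g`: `reindex e₁ (T g T⁻¹ ⊗ 1)`
  have hMmat : ∀ g, ((M g : GL (Fin n') (UnitaryGroup.LocalRing L v)) : Matrix (Fin n') (Fin n') (UnitaryGroup.LocalRing L v)) =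
      Matrix.reindex e₁ e₁ (((T : Matrix (Fin 3) (Fin 3) (UnitaryGroup.LocalRing L v)) * ((g.val : GL (Fin 3) _) : Matrix (Fin 3) (Fin 3) _) *
        ((T⁻¹ : GL (Fin 3) (UnitaryGroup.LocalRing L v)) : Matrix (Fin 3) (Fin 3) _)) ⊗ₖ (1 : Matrix (Fin 1) (Fin 1) (UnitaryGroup.LocalRing L v))) := by
    intro g
    rw [hMval, hchap, hdock, coe_cmDatumLocalCongr_apply, Units.val_mul, Units.val_mul]

  -- the matrix of the chain, by name
  have hgm : ∀ g : (cmDatum L 3 (Matrix.of fun i j : Fin 3 => if i.val + j.val + 1 = 3 then (1 : L) else 0)).Local v,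
      (((localPiEquiv L (IsCMField.complexConj L) n' (Matrix.reindex e₁ e₁ (Matrix.diagonal dV ⊗ₖ JW (↥(maximalRealSubfield L)) L ε)) v
          (localLineInl L (IsCMField.complexConj L) 3 e₁ (Matrix.diagonal dV) (JW (↥(maximalRealSubfield L)) L ε) v
            ((localPiEquiv L (IsCMField.complexConj L) 3 (Matrix.diagonal dV) v).symm (cmDatumLocalCongr L v T ha h g))) :
          ↥(UnitaryGroup.«local» L (IsCMField.complexConj L) n' (Matrix.reindex e₁ e₁ (Matrix.diagonal dV ⊗ₖ JW (↥(maximalRealSubfield L)) L ε)) v)) :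
          GL (Fin n') (UnitaryGroup.LocalRing L v)) : Matrix (Fin n') (Fin n') (UnitaryGroup.LocalRing L v)) =
        ((M g : GL (Fin n') (UnitaryGroup.LocalRing L v)) : Matrix (Fin n') (Fin n') (UnitaryGroup.LocalRing L v)) := fun g => by
    rw [hMval, hchap]
  -- the Borel data of `U(Φ₃)(L⁺_v)` over the FIELD `S` (non-split `v`)
  have hJ3 := cmLocalForm_eq_over L 3 v
  letI : Field (UnitaryGroup.LocalRing L v) := hS.toField
  -- THE FRAME: `y = Lf (T e₀)`, `ys = Lf (u⁻¹ T e₂)`, `b₀ = Lf (T e₁)`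
  have hyy := pairFrame_hx (conjLocal L (IsCMField.complexConj L) v) HV HW e₁ Lf hLf T u hcc
  have hys := pairFrame_hxy (conjLocal L (IsCMField.complexConj L) v) HV HW e₁ Lf hLf T u hcc
  have hsy : hermForm (conjLocal L (IsCMField.complexConj L) v) (Matrix.reindex e₁ e₁ (HV ⊗ₖ HW))
      (Lf (((u⁻¹ : (UnitaryGroup.LocalRing L v)ˣ) : UnitaryGroup.LocalRing L v) • (T : Matrix (Fin 3) (Fin 3) _).col 2))
      (Lf ((T : Matrix (Fin 3) (Fin 3) _).col 0)) = 1 := by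
    rw [map_smul, hermForm_smul_left_eq, hermForm_pair_col_col (conjLocal L (IsCMField.complexConj L) v) HV HW e₁ Lf hLf T u hcc]
    simp only [Fin.val_two, Fin.val_zero, Nat.reduceAdd, ↓reduceIte]
    rw [map_units_inv_of_map_eq _ hσu, Units.inv_mul]
  -- the expansion of a vector orthogonal to `y`: `b = h(ys,b) • y + c • b₀`
  have hexp : ∀ b : Fin n' → UnitaryGroup.LocalRing L v, hermForm (conjLocal L (IsCMField.complexConj L) v) (Matrix.reindex e₁ e₁ (HV ⊗ₖ HW))
      (Lf ((T : Matrix (Fin 3) (Fin 3) _).col 0)) b = 0 →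
      b = hermForm (conjLocal L (IsCMField.complexConj L) v) (Matrix.reindex e₁ e₁ (HV ⊗ₖ HW))
            (Lf (((u⁻¹ : (UnitaryGroup.LocalRing L v)ˣ) : UnitaryGroup.LocalRing L v) • (T : Matrix (Fin 3) (Fin 3) _).col 2)) b •
          Lf ((T : Matrix (Fin 3) (Fin 3) _).col 0) +
        (((u⁻¹ : (UnitaryGroup.LocalRing L v)ˣ) : UnitaryGroup.LocalRing L v) *
          hermForm (conjLocal L (IsCMField.complexConj L) v) (Matrix.reindex e₁ e₁ (HV ⊗ₖ HW)) (Lf ((T : Matrix (Fin 3) (Fin 3) _).col 1)) b) •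
          Lf ((T : Matrix (Fin 3) (Fin 3) _).col 1) := by
    intro b hb
    have hx := pairFrame_hexp (conjLocal L (IsCMField.complexConj L) v) HV HW e₁ Lf hLf T u hcc hσu b
    rw [hb, zero_smul, add_zero, Fin.sum_univ_one, Matrix.cons_val_zero] at hx
    exact hx
  refine ⟨Lf ((T : Matrix (Fin 3) (Fin 3) _).col 0), Lf (((u⁻¹ : (UnitaryGroup.LocalRing L v)ˣ) : UnitaryGroup.LocalRing L v) • (T : Matrix (Fin 3) (Fin 3) _).col 2),
    ?_, ?_, ?_, ?_, ?_⟩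
  · rw [hH]; exact hyy
  · rw [hH]; exact hsy
  · rw [hH]; exact hys
  · -- (N): an element of the unipotent radical is upper unitriangular in the frame
    intro nn hnn
    obtain ⟨x, z, hmat, -⟩ := exists_coe_eq_upper_of_mem_unipotentU (conjLocal L (IsCMField.complexConj L) v) hJ3 hσσ hnn
    have hMn := hMmat (nn : ↥(unitaryGroupOfForm (conjLocal L (IsCMField.complexConj L) v) (cmLocalForm L 3 v)))
    rw [show ((((nn : ↥(unitaryGroupOfForm (conjLocal L (IsCMField.complexConj L) v) (cmLocalForm L 3 v))) :
        (cmDatum L 3 (Matrix.of fun i j : Fin 3 => if i.val + j.val + 1 = 3 then (1 : L) else 0)).Local v).val : GL (Fin 3) _) :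
        Matrix (Fin 3) (Fin 3) (UnitaryGroup.LocalRing L v)) = !![1, x, z; 0, 1, -(conjLocal L (IsCMField.complexConj L) v x); 0, 0, 1] from hmat] at hMn
    obtain ⟨h0, h1, -⟩ := pairFrame_action_upper e₁ Lf hLf T u x (-(conjLocal L (IsCMField.complexConj L) v x)) z
    refine ⟨?_, fun b hb => ?_⟩
    · rw [hgm, hMn, h0, one_smul]
    · obtain ⟨μ, hμ⟩ := h1 0
      rw [Matrix.cons_val_zero] at hμ
      rw [hH] at hb
      exact ⟨_, by rw [hgm, hMn]; exact mulVec_eq_add_smul_of_two_term _ (hexp b hb) (by rw [h0, one_smul]) hμ⟩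
  · -- (T): a torus element with middle entry `1` is `diag(α, 1, ᾱ⁻¹)` in the frame
    intro t ht1
    obtain ⟨dd, hdd, -⟩ := exists_coe_eq_diagonal_of_mem_torusU (conjLocal L (IsCMField.complexConj L) v) hJ3 t.2
    have hdd0 : dd 0 = torusEntry (conjLocal L (IsCMField.complexConj L) v) (cmLocalForm L 3 v) 0 t := by
      refine Units.ext ?_
      rw [coe_torusEntry, hdd, Matrix.diagonal_apply_eq]
    have hdd1 : ((dd 1 : (UnitaryGroup.LocalRing L v)ˣ) : UnitaryGroup.LocalRing L v) = 1 := by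
      have h1 := coe_torusEntry (conjLocal L (IsCMField.complexConj L) v) (cmLocalForm L 3 v) 1 t
      rw [ht1, Units.val_one, hdd, Matrix.diagonal_apply_eq] at h1
      exact h1.symm
    have hMt := hMmat (t : ↥(unitaryGroupOfForm (conjLocal L (IsCMField.complexConj L) v) (cmLocalForm L 3 v)))
    rw [show ((((t : ↥(unitaryGroupOfForm (conjLocal L (IsCMField.complexConj L) v) (cmLocalForm L 3 v))) :
        (cmDatum L 3 (Matrix.of fun i j : Fin 3 => if i.val + j.val + 1 = 3 then (1 : L) else 0)).Local v).val : GL (Fin 3) _) :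
        Matrix (Fin 3) (Fin 3) (UnitaryGroup.LocalRing L v)) =
        Matrix.diagonal (fun i => ((dd i : (UnitaryGroup.LocalRing L v)ˣ) : UnitaryGroup.LocalRing L v)) from hdd] at hMt
    have h0 : ((M (t : ↥(unitaryGroupOfForm (conjLocal L (IsCMField.complexConj L) v) (cmLocalForm L 3 v))) : GL (Fin n') (UnitaryGroup.LocalRing L v)) :
        Matrix (Fin n') (Fin n') _) *ᵥ Lf ((T : Matrix (Fin 3) (Fin 3) _).col 0) =
        ((dd 0 : (UnitaryGroup.LocalRing L v)ˣ) : UnitaryGroup.LocalRing L v) • Lf ((T : Matrix (Fin 3) (Fin 3) _).col 0) := by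
      rw [hMt, reindex_kronecker_one_mulVec e₁ Lf hLf, conj_diagonal_mulVec_col T _ 0, map_smul]
    have h1 : ((M (t : ↥(unitaryGroupOfForm (conjLocal L (IsCMField.complexConj L) v) (cmLocalForm L 3 v))) : GL (Fin n') (UnitaryGroup.LocalRing L v)) :
        Matrix (Fin n') (Fin n') _) *ᵥ Lf ((T : Matrix (Fin 3) (Fin 3) _).col 1) =
        Lf ((T : Matrix (Fin 3) (Fin 3) _).col 1) + (0 : UnitaryGroup.LocalRing L v) • Lf ((T : Matrix (Fin 3) (Fin 3) _).col 0) := by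
      rw [hMt, reindex_kronecker_one_mulVec e₁ Lf hLf, conj_diagonal_mulVec_col T _ 1, hdd1, one_smul, zero_smul, add_zero]
    refine ⟨?_, fun b hb => ?_⟩
    · rw [hgm, h0, hdd0]
    · rw [hH] at hb
      exact ⟨_, by rw [hgm]; exact mulVec_eq_add_smul_of_two_term _ (hexp b hb) h0 h1⟩

end Summit.HodgeConjecture.HodgeConjecture.Cruxes.H413.F0P2oThetaJacquetTorusFrame

end
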